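import Summits.QuantumFields.YangMills.Theorems.LuscherReductionTwistedTraceScalingSliceSmooth
import Summits.QuantumFields.YangMills.Theorems.LuscherReductionTwistedTraceScalingRecordWeight
import Summits.QuantumFields.YangMills.Theorems.LuscherReductionTwistedTraceScalingVacGradKernel
import HarnessLib

/-!
# The record weight is invariant under GLOBAL colour rotations (constant gauge transformations): the constant gauge modes integrate out of the Faddeev–Popov weight exactly
# (lane A of S-BASE, crux `TwistedTraceScaling` stmt-QuantumFields-20203, C4 INNER; design note `pub/ym-fleet/ym-luscher-20007-p1/COARSE-DESIGN.md` §23.8 (N2))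

The Faddeev–Popov weight `N(U*) = ∫ recordWeight(U*^g) dg` of `…RecordWeight` is an integral over ALL gauge transformations; the Gaussian evaluation (N2) linearises
in the MEAN-ZERO gauge parameters only (`…SliceMeets`, `…SliceEquiv`).  THIS FILE shows the constant ones are harmless: for a constant `g`, `U ↦ g·U·g⁻¹`
* rotates the relative coordinate: ★ `relLinkVec_conj`: `relLinkVec(gUg⁻¹) = Ad(g)·relLinkVec(U)` (`polarMean_conj`, `dirQuat_conj`);
* `Ad(g)` is a linear ISOMETRY of the link space (`adL`) preserving the vacuum gauge modes `Γ` (★ `map_adL_gaugeModes`), hence commutes with `P_Γ`: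
  ★★ `gaugeCoordSq_conj`: `gaugeCoordSq(gUg⁻¹) = gaugeCoordSq(U)`;
* preserves the fat tube (`fatTube_conj_iff`), hence ★★ `recordWeight_conj`: `recordWeight(gUg⁻¹) = recordWeight(U)`.
So in the equivariant factorisation `g = g₀·g⊥` of the gauge group (constants × rest) the `g₀`-integral is trivial (N2, §23.8).
HONEST FRAMING: symmetry bookkeeping for a stub of a child of the CONDITIONAL reduction route R2b1; no spectral claim; C4 OPEN; not a gap, not Clay.
-/

set_option autoImplicit false

noncomputable section

open Real
open scoped BigOperators Matrix Quaternion
open Literature.MathematicalPhysics.QuantumFieldTheory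
open Literature.MathematicalPhysics.QuantumLattice

namespace Summit.QuantumFields.YangMills.Theorems.FemtoTransferGap.TwoLattice.ConstTube

open Summit.QuantumFields.YangMills.Theorems.FemtoTransferGap
open Summit.QuantumFields.YangMills.Theorems.FemtoTransferGap.TwoLattice.Stiff (LinkSpace)
open Summit.QuantumFields.YangMills.Theorems.FemtoTransferGap.TwoLattice.Cov (adRot_mul adRot_one sum_sq_adRot_mulVec)
open Literature.MathematicalPhysics.QuantumFieldTheory.Balaban1983to89.T4WilsonLinkAffine (su2Quat_inv)

variable (L : ℕ) [NeZero L]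

/-! ## §1 `Ad(g)` as a linear isometry of the link space preserving `Γ` -/

/-- Pointwise adjoint rotation of a link-space vector (as a linear map). [folklore] -/
def adLin (g : SU2) : LinkSpace L →ₗ[ℝ] LinkSpace L where
  toFun v := WithLp.toLp 2 fun ea : Edge 3 L × Fin 3 => ((adRot g).mulVec fun b => v (ea.1, b)) ea.2
  map_add' v w := by
    ext ea
    simp only [WithLp.ofLp_add, Pi.add_apply]
    rw [show (fun b => v.ofLp (ea.1, b) + w.ofLp (ea.1, b)) = (fun b => v.ofLp (ea.1, b)) + fun b => w.ofLp (ea.1, b) from rfl,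
      Matrix.mulVec_add, Pi.add_apply]
  map_smul' c v := by
    ext ea
    simp only [WithLp.ofLp_smul, Pi.smul_apply, smul_eq_mul, RingHom.id_apply]
    rw [show (fun b => c * v.ofLp (ea.1, b)) = c • fun b => v.ofLp (ea.1, b) from rfl, Matrix.mulVec_smul, Pi.smul_apply, smul_eq_mul]

omit [NeZero L] in
/-- Components of `adLin`. [folklore] -/
theorem adLin_apply (g : SU2) (v : LinkSpace L) (e : Edge 3 L) (a : Fin 3) : adLin L g v (e, a) = ((adRot g).mulVec fun b => v (e, b)) a := rfl

omit [NeZero L] in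
/-- `adLin` is multiplicative. [folklore] -/
theorem adLin_mul_apply (g h : SU2) (v : LinkSpace L) : adLin L (g * h) v = adLin L g (adLin L h v) := by
  ext ea
  rw [show ea = (ea.1, ea.2) from rfl, adLin_apply, adLin_apply, adRot_mul, ← Matrix.mulVec_mulVec]
  rfl

omit [NeZero L] in
/-- `adLin 1 = id`. [folklore] -/
theorem adLin_one_apply (v : LinkSpace L) : adLin L 1 v = v := by
  ext ea
  rw [show ea = (ea.1, ea.2) from rfl, adLin_apply, adRot_one, Matrix.one_mulVec]

/-- `adLin` preserves the norm. [folklore] -/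
theorem norm_adLin (g : SU2) (v : LinkSpace L) : ‖adLin L g v‖ = ‖v‖ := by
  have e1 : ∑ x : Edge 3 L × Fin 3, (adLin L g v x) ^ 2 = ∑ e : Edge 3 L, ∑ a : Fin 3, (adLin L g v (e, a)) ^ 2 := Fintype.sum_prod_type _
  have e2 : ∑ x : Edge 3 L × Fin 3, (v x) ^ 2 = ∑ e : Edge 3 L, ∑ a : Fin 3, (v (e, a)) ^ 2 := Fintype.sum_prod_type _
  have h : ‖adLin L g v‖ ^ 2 = ‖v‖ ^ 2 := by
    simp only [EuclideanSpace.norm_sq_eq, Real.norm_eq_abs, sq_abs]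
    rw [e1, e2]
    exact Finset.sum_congr rfl fun e _ => sum_sq_adRot_mulVec g (fun b => v (e, b))
  rw [← Real.sqrt_sq (norm_nonneg (adLin L g v)), ← Real.sqrt_sq (norm_nonneg v), h]

/-- ★ `Ad(g)` as a linear isometry equivalence of the link space. [folklore] -/
def adL (g : SU2) : LinkSpace L ≃ₗᵢ[ℝ] LinkSpace L where
  toLinearEquiv :=
    { adLin L g with
      invFun := adLin L g⁻¹
      left_inv := fun v => by
        show adLin L g⁻¹ (adLin L g v) = v
        rw [← adLin_mul_apply, inv_mul_cancel, adLin_one_apply]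
      right_inv := fun v => by
        show adLin L g (adLin L g⁻¹ v) = v
        rw [← adLin_mul_apply, mul_inv_cancel, adLin_one_apply] }
  norm_map' := norm_adLin L g

/-- `adL g v = adLin g v`. [folklore] -/
theorem adL_apply (g : SU2) (v : LinkSpace L) : adL L g v = adLin L g v := rfl

/-- `Ad(g)` commutes with the vacuum gradient: `Ad(g)(∇ξ) = ∇(Ad(g)ξ)`. [folklore] -/
theorem adL_vacGrad (g : SU2) (ξ : Site 3 L → Fin 3 → ℝ) : adL L g (vacGrad L ξ) = vacGrad L (fun x => (adRot g).mulVec (ξ x)) := by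
  ext ea
  rw [show ea = (ea.1, ea.2) from rfl, adL_apply, adLin_apply, vacGrad_apply]
  have h : (fun b => vacGrad L ξ (ea.1, b)) = ξ (ea.1.1.shift ea.1.2) - ξ ea.1.1 := by
    funext b; rw [vacGrad_apply]; rfl
  rw [h, Matrix.mulVec_sub, Pi.sub_apply]

/-- ★ The vacuum gauge modes are `Ad`-invariant: `Γ.map Ad(g) = Γ`. [folklore] -/
theorem map_adL_gaugeModes (g : SU2) : (gaugeModes L).map ((adL L g).toLinearEquiv : LinkSpace L →ₗ[ℝ] LinkSpace L) = gaugeModes L := by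
  refine le_antisymm ?_ ?_
  · rintro v ⟨w, ⟨ξ, rfl⟩, rfl⟩
    exact ⟨fun x => (adRot g).mulVec (ξ x), (adL_vacGrad L g ξ).symm⟩
  · rintro v ⟨ξ, rfl⟩
    refine ⟨adL L g⁻¹ (vacGrad L ξ), ⟨fun x => (adRot g⁻¹).mulVec (ξ x), (adL_vacGrad L g⁻¹ ξ).symm⟩, ?_⟩
    show adLin L g (adLin L g⁻¹ (vacGrad L ξ)) = vacGrad L ξ
    rw [← adLin_mul_apply, mul_inv_cancel, adLin_one_apply]

/-- ★ `P_Γ` commutes with `Ad(g)`: `P_Γ(Ad(g)v) = Ad(g)(P_Γ v)`. [folklore] -/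
theorem starProjection_adL (g : SU2) (v : LinkSpace L) : (gaugeModes L).starProjection (adL L g v) = adL L g ((gaugeModes L).starProjection v) := by
  have h := Submodule.starProjection_map_apply (adL L g) (gaugeModes L) (adL L g v)
  rw [LinearIsometryEquiv.symm_apply_apply] at h
  simp only [map_adL_gaugeModes] at h
  exact h

/-! ## §2 The relative coordinate under global colour rotations -/

omit [NeZero L] in
/-- A constant gauge transformation conjugates every link. [folklore] -/
theorem gaugeTransform_const_apply' (g : SU2) (U : GaugeConfig 3 L SU2) (e : Edge 3 L) : gaugeTransform (fun _ => g) U e = g * U e * g⁻¹ := rfl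

/-- The direction sum conjugates: `dirQuat(gUg⁻¹) = q(g)·dirQuat(U)·q(g)⁻¹`. [folklore] -/
theorem dirQuat_conj (g : SU2) (U : GaugeConfig 3 L SU2) (k : Fin 3) :
    dirQuat L k (gaugeTransform (fun _ => g) U) = su2Quat g * dirQuat L k U * star (su2Quat g) := by
  rw [dirQuat_eq_sum_su2Quat, dirQuat_eq_sum_su2Quat, Finset.mul_sum, Finset.sum_mul]
  refine Finset.sum_congr rfl fun x _ => ?_
  rw [gaugeTransform_const_apply', su2Quat_mul, su2Quat_mul, su2Quat_inv]

omit [NeZero L] in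
/-- `quatToSU2 0 = 1`. [folklore] -/
theorem quatToSU2_zero : quatToSU2 (0 : ℍ) = 1 := by simp [quatToSU2]

/-- ★ The polar mean conjugates: `p_k(gUg⁻¹) = g·p_k(U)·g⁻¹`. [folklore] -/
theorem polarMean_conj (g : SU2) (U : GaugeConfig 3 L SU2) (k : Fin 3) :
    polarMean L k (gaugeTransform (fun _ => g) U) = g * polarMean L k U * g⁻¹ := by
  unfold polarMean
  rw [dirQuat_conj]
  by_cases hM : dirQuat L k U = 0
  · rw [hM, mul_zero, zero_mul, quatToSU2_zero, mul_one, mul_inv_cancel]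
  · have h1 : su2Quat g * dirQuat L k U ≠ 0 := mul_ne_zero (su2Quat_ne_zero g) hM
    rw [← su2Quat_inv, quatToSU2_mul_su2Quat h1, ← mul_quatToSU2 g hM]

/-- ★ **The relative coordinate rotates**: `relLinkVec(gUg⁻¹) = Ad(g)·relLinkVec(U)`. [folklore] -/
theorem relLinkVec_conj (g : SU2) (U : GaugeConfig 3 L SU2) : relLinkVec L (gaugeTransform (fun _ => g) U) = adL L g (relLinkVec L U) := by
  ext ea
  rw [show ea = (ea.1, ea.2) from rfl, adL_apply, adLin_apply]
  show vecPart (gaugeTransform (fun _ => g) U ea.1 * (polarMean L ea.1.2 (gaugeTransform (fun _ => g) U))⁻¹) ea.2 = _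
  rw [polarMean_conj, gaugeTransform_const_apply']
  have h : g * U ea.1 * g⁻¹ * (g * polarMean L ea.1.2 U * g⁻¹)⁻¹ = g * (U ea.1 * (polarMean L ea.1.2 U)⁻¹) * g⁻¹ := by group
  rw [h, vecPart_conj]
  rfl

/-- ★★ **The squared gauge coordinate is invariant under global colour rotations.** [folklore] -/
theorem gaugeCoordSq_conj (g : SU2) (U : GaugeConfig 3 L SU2) : gaugeCoordSq L (gaugeTransform (fun _ => g) U) = gaugeCoordSq L U := by
  unfold gaugeCoordSq
  rw [relLinkVec_conj, starProjection_adL, LinearIsometryEquiv.norm_map]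

/-! ## §3 The fat tube and the record weight -/

/-- The fat tube is invariant under global colour rotations. [folklore] -/
theorem conj_mem_fatTube_iff (g : SU2) (δ : ℝ → ℝ) (β : ℝ) (U : GaugeConfig 3 L SU2) :
    gaugeTransform (fun _ => g) U ∈ fatTube L δ β ↔ U ∈ fatTube L δ β := by
  have hnear : ∀ ρ : ℝ, gaugeTransform (fun _ => g) U ∈ nearOne L ρ ↔ U ∈ nearOne L ρ := fun ρ => by
    have hlink : ∀ e : Edge 3 L, frobNorm (((gaugeTransform (fun _ => g) U e : SU2) : Matrix (Fin 2) (Fin 2) ℂ) - 1) =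
        frobNorm (((U e : SU2) : Matrix (Fin 2) (Fin 2) ℂ) - 1) := fun e => by
      have h1 : gaugeTransform (fun _ : Site 3 L => g) (1 : GaugeConfig 3 L SU2) e = 1 := by
        rw [gaugeTransform_const_apply', Pi.one_apply, mul_one, mul_inv_cancel]
      have h := frobNorm_gaugeTransform_sub (fun _ => g) U 1 e
      rwa [h1, Pi.one_apply, OneMemClass.coe_one] at h
    simp only [nearOne, Set.mem_setOf_eq, hlink]
  simp only [fatTube, Set.mem_inter_iff, hnear, Set.mem_setOf_eq, orbitDist_gaugeTransform]

/-- ★★ **THE RECORD WEIGHT IS INVARIANT UNDER GLOBAL COLOUR ROTATIONS**: `recordWeight(gUg⁻¹) = recordWeight(U)`. [folklore] -/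
theorem recordWeight_conj (g : SU2) (δ δg : ℝ → ℝ) (β : ℝ) (U : GaugeConfig 3 L SU2) :
    recordWeight L δ δg β (gaugeTransform (fun _ => g) U) = recordWeight L δ δg β U := by
  unfold recordWeight
  rw [gaugeCoordSq_conj]
  congr 1
  by_cases hU : U ∈ fatTube L δ β
  · rw [Set.indicator_of_mem hU, Set.indicator_of_mem ((conj_mem_fatTube_iff L g δ β U).mpr hU)]
  · rw [Set.indicator_of_notMem hU, Set.indicator_of_notMem (fun h => hU ((conj_mem_fatTube_iff L g δ β U).mp h))]

end Summit.QuantumFields.YangMills.Theorems.FemtoTransferGap.TwoLattice.ConstTube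

end
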